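import Literature.AlgebraicGeometry.Motives.CoherentFracFamily
import Mathlib.RingTheory.Ideal.AssociatedPrime.Basic
import Mathlib.AlgebraicGeometry.Noetherian
import HarnessLib

/-!
# The colon family of a pair of coherent families along an associated point
# (rank-one dévissage of coherent modules, The Stacks Project Tag 01YF, step one)

Let `Z` be an integral locally Noetherian scheme, `𝔘` the intersections of a finite affine cover
(`Motives/CoherentFracFamily`: `FracFamily.CoverData`) and `L' ≤ L` two coherent families of
rational functions on `𝔘` (`FracFamily.IsCoherent`: the sections `Γ(U_t, 𝓛') ⊆ Γ(U_t, 𝓛) ⊆ K(Z)`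
of coherent submodules `𝓛' ⊆ 𝓛 ⊆ 𝒦_Z`). The classical dévissage of coherent modules (The Stacks
Project, Tag 01YF: every coherent module on a Noetherian scheme has a filtration whose graded pieces
are `(Z₁ ↪ Z)_* 𝓘` for integral closed `Z₁` and coherent `𝓘 ⊆ 𝒪_{Z₁}`; Görtz–Wedhorn I,
Lemma 12.63; EGA III 3.1.2) starts by choosing an ASSOCIATED POINT `ζ` of `𝓛/𝓛'` and passing to
the subsheaf of sections of `𝓛/𝓛'` killed by the ideal `𝔭` of `Z₁ = closure {ζ}`. This file does
this inside `K(Z)`: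

* `FracFamily.IsAssPt 𝔘 L L' y` — `y` is an associated point of `𝓛/𝓛'`: some `x ∈ 𝓛_y` has
  `x ∉ 𝓛'_y` and `𝔪_y x ⊆ 𝓛'_y` (stalks `𝓛_y = 𝒪_{Z,y} · L {a}`, `FracFamily.stalkSpan`);
  `exists_isAssPt` — **associated points exist** as soon as `L' t ≠ L t` (Mathlib
  `associatedPrimes.nonempty` for the finitely generated `Γ(U_t)`-module `L t / L' t`);
  `exists_isAssPt_minimal` — on a Noetherian space one of them, `ζ`, has NO OTHER associated point
  in its closure (well-foundedness of closed subsets);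
* `FracFamily.pointIdeal hV ζ ⊆ Γ(V, 𝒪_Z)` — the ideal of `closure {ζ} ∩ V` on an affine chart
  (Mathlib `Scheme.IdealSheafData.vanishingIdeal`), read through units of rational functions
  (`mem_pointIdeal_iff`, `mem_pointIdeal_iff_of_mem`, `exists_mem_pointIdeal_isUnitAt`);
* `FracFamily.colonFam 𝔘 ζ L L' t = Γ(U_t, (𝓛' :_𝓛 𝔭))` — the sections `x` of `𝓛` over `U_t`
  with `f x ∈ 𝓛'_y` for all `y ∈ U_t` and all `f ∈ 𝔭_y` (`f` regular at `y`, and a non-unit at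
  `ζ` if `ζ ⤳ y`), and its properties: `L' ≤ colonFam ≤ L`; the chart description
  `colonFam t = (L' t :_{L t} pointIdeal ζ)` (`mem_colonFam_iff`); **coherence**
  (`isCoherent_colonFam`); `colonFam t = L' t` on the charts missing `ζ` (`colonFam_eq_of_notMem`);
  and the KEY LEMMA `mem_of_mem_colonFam_of_mem_stalkSpan` — **if `ζ` has no other associated
  point in its closure, a section of `(𝓛' :_𝓛 𝔭)` over `U_t ∋ ζ` lying in `𝓛'_ζ` lies in
  `Γ(U_t, 𝓛')`** (an associated prime of `L t / L' t` above the annihilator of its class would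
  give an associated point `y ≠ ζ` with `ζ ⤳ y`; Mathlib `exists_le_isAssociatedPrime_of_isNoetherianRing`),
  i.e. `(𝓛' :_𝓛 𝔭)/𝓛'` is a torsion-free `𝒪_{Z₁}`-module embedded in its generic stalk;
* `exists_mem_colonFam_notMem` — a section of `(𝓛' :_𝓛 𝔭)` over a vertex chart through `ζ`
  which is not in `𝓛'_ζ` (the generator of the rank-one piece cut out in the sequel).

Everything is proved; no named facts. Mathlib searched (pin v4.32): `associatedPrimes.nonempty`,
`isAssociatedPrime_iff`, `exists_le_isAssociatedPrime_of_isNoetherianRing`,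
`Submodule.mem_colon_singleton`, `Scheme.IdealSheafData.vanishingIdeal(_ideal)`,
`PrimeSpectrum.mem_vanishingIdeal`, `Specializes.mem_open`, `Inseparable.eq`,
`WellFoundedLT (Closeds _)` for Noetherian spaces (used).

## References

* The Stacks Project, Tag 01YF (Cohomology of Schemes, dévissage of coherent modules on
  Noetherian schemes) and Tag 02M3, 05AF (associated primes and points).
* U. Görtz, T. Wedhorn, *Algebraic Geometry I: Schemes*, 2nd ed. (2020), Lemma 12.63 (PDF p. 436).
  [GortzWedhorn2020]
* U. Görtz, T. Wedhorn, *Algebraic Geometry II* (2023), Thm. 23.17, proof (PDF pp. 424–425).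
  [GortzWedhorn2023]
-/

universe u v

open CategoryTheory AlgebraicGeometry TopologicalSpace Opposite

noncomputable section

namespace Literature.AlgebraicGeometry.Motives

namespace FracFamily

open RatFn

variable {Z : Scheme.{u}} [IsIntegral Z]
variable {A : Type v} [CommRing A] [Algebra A Z.functionField]

/-! ### Units of rational functions along specialisations -/

omit [IsIntegral Z] in
/-- If `ζ ⤳ y` and `y` lies in the open `U`, then so does `ζ`. [folklore] -/
theorem mem_of_specializes_of_mem {ζ y : Z} (h : ζ ⤳ y) {U : Z.Opens} (hy : y ∈ U) : ζ ∈ U :=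
  h.mem_open U.2 hy

/-- **Units at `y` are units at every generisation `ζ ⤳ y`** (the unit locus of a rational function
is open). [folklore] -/
theorem isUnitAt_of_specializes {ζ y : Z} (h : ζ ⤳ y) {f : Z.functionField} (hf : IsUnitAt y f) :
    IsUnitAt ζ f :=
  h.mem_open (isOpen_setOf_isUnitAt f) hf

/-! ### The ideal of the closure of a point on an affine chart -/

section PointIdeal

variable {V : Z.Opens} (hV : IsAffineOpen V)

/-- **The ideal of `closure {ζ} ∩ V` in `Γ(V, 𝒪_Z)`** for an affine open `V` (Mathlib's radical
vanishing ideal sheaf of the closed set `closure {ζ}`, evaluated on the chart). [folklore] -/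
def pointIdeal (ζ : Z) : Ideal Γ(Z, V) :=
  (Scheme.IdealSheafData.vanishingIdeal ⟨closure {ζ}, isClosed_closure⟩).ideal ⟨V, hV⟩

set_option backward.isDefEq.respectTransparency false in
/-- **Membership in the ideal of `closure {ζ}`**: `a ∈ 𝔭_V(ζ)` iff the rational function of `a` is
a non-unit at every point of `V` to which `ζ` specialises. [folklore] -/
theorem mem_pointIdeal_iff [Nonempty V] (ζ : Z) (a : Γ(Z, V)) :
    a ∈ pointIdeal hV ζ ↔
      ∀ y : V, ζ ⤳ (y : Z) → ¬IsUnitAt (y : Z) (algebraMap Γ(Z, V) Z.functionField a) := by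
  unfold pointIdeal
  rw [Scheme.IdealSheafData.vanishingIdeal_ideal, PrimeSpectrum.mem_vanishingIdeal]
  constructor
  · intro h y hy
    rw [isUnitAt_algebraMap_iff hV y a, not_not]
    refine h (hV.primeIdealOf y) ?_
    change hV.fromSpec (hV.primeIdealOf y) ∈ closure {ζ}
    rw [hV.fromSpec_primeIdealOf]
    exact specializes_iff_mem_closure.1 hy
  · intro h q hq
    change hV.fromSpec q ∈ closure {ζ} at hq
    have hy := h ⟨hV.fromSpec q, FieldNorm.fromSpec_mem hV q⟩ (specializes_iff_mem_closure.2 hq)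
    rw [isUnitAt_algebraMap_iff hV _ a, not_not, FieldNorm.primeIdealOf_fromSpec hV q] at hy
    exact hy

/-- On a chart through `ζ`, **`a ∈ 𝔭_V(ζ)` iff `a` vanishes at `ζ`** (a function vanishing at `ζ`
vanishes on its closure). [folklore] -/
theorem mem_pointIdeal_iff_of_mem [Nonempty V] {ζ : Z} (hζ : ζ ∈ V) (a : Γ(Z, V)) :
    a ∈ pointIdeal hV ζ ↔ ¬IsUnitAt ζ (algebraMap Γ(Z, V) Z.functionField a) := by
  rw [mem_pointIdeal_iff hV ζ a]
  exact ⟨fun h => h ⟨ζ, hζ⟩ specializes_rfl, fun h y hy hu => h (isUnitAt_of_specializes hy hu)⟩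

/-- **A point outside `closure {ζ}` is avoided by `𝔭_V(ζ)`**: some function of the ideal is a unit
there (`V(𝔭_V(ζ)) = closure {ζ} ∩ V`; Görtz–Wedhorn I, Prop. 2.3 (2)). [folklore] -/
theorem exists_mem_pointIdeal_isUnitAt [Nonempty V] {ζ : Z} (y : V) (hy : ¬ζ ⤳ (y : Z)) :
    ∃ a ∈ pointIdeal hV ζ, IsUnitAt (y : Z) (algebraMap Γ(Z, V) Z.functionField a) := by
  have h : ¬pointIdeal hV ζ ≤ (hV.primeIdealOf y).asIdeal := by
    unfold pointIdeal
    rw [vanishingIdeal_ideal_le_primeIdealOf_iff hV ⟨closure {ζ}, isClosed_closure⟩ y]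
    exact fun hc => hy (specializes_iff_mem_closure.2 hc)
  obtain ⟨a, ha, hay⟩ := SetLike.not_le_iff_exists.1 h
  exact ⟨a, ha, (isUnitAt_algebraMap_iff hV y a).2 hay⟩

/-- **Restriction preserves the ideal of `closure {ζ}`.** [folklore] -/
theorem map_mem_pointIdeal [Nonempty V] {W : Z.Opens} (hW : IsAffineOpen W) [Nonempty W]
    (hWV : W ≤ V) (ζ : Z) {a : Γ(Z, V)} (ha : a ∈ pointIdeal hV ζ) :
    Z.presheaf.map (homOfLE hWV).op a ∈ pointIdeal hW ζ := by
  rw [mem_pointIdeal_iff] at ha ⊢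
  intro y hy
  rw [algebraMap_map hWV a]
  exact ha ⟨y, hWV y.2⟩ hy

end PointIdeal

/-! ### Associated points of a pair of coherent families -/

section AssPt

variable {ι : Type} (𝔘 : CoverData Z ι) (L L' : Finset ι → Submodule A Z.functionField)

/-- **`y` is an associated point of `𝓛/𝓛'`**: on a vertex chart `U_{a} ∋ y`, some `x` of the stalk
`𝓛_y = 𝒪_{Z,y} · L {a}` is not in `𝓛'_y` while `𝔪_y x ⊆ 𝓛'_y` (i.e. `𝔪_y` is the annihilator of
the class of `x` in `𝓛_y/𝓛'_y`; The Stacks Project, Tag 05AF / 02M3). [folklore] -/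
def IsAssPt (y : Z) : Prop :=
  ∃ a : ι, y ∈ 𝔘.U {a} ∧ ∃ x ∈ stalkSpan (A := A) y (L {a} : Set Z.functionField),
    x ∉ stalkSpan (A := A) y (L' {a} : Set Z.functionField) ∧
      ∀ f : Z.functionField, IsRegularAt y f → ¬IsUnitAt y f →
        f * x ∈ stalkSpan (A := A) y (L' {a} : Set Z.functionField)

omit [IsIntegral Z] in
/-- Points with equal closures of a T₀ space are equal. [folklore] -/
theorem eq_of_closure_eq {y ζ : Z} (h : closure ({y} : Set Z) = closure {ζ}) : y = ζ := by
  have h1 : ζ ⤳ y := specializes_iff_mem_closure.2 (h ▸ subset_closure (Set.mem_singleton y))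
  have h2 : y ⤳ ζ := specializes_iff_mem_closure.2 (h ▸ subset_closure (Set.mem_singleton ζ))
  exact (h2.antisymm h1).eq

/-- **A minimal associated point**: on a Noetherian space, if `𝓛/𝓛'` has an associated point then
it has one, `ζ`, such that no other associated point lies in `closure {ζ}` (take `closure {ζ}`
minimal among the closures of associated points). [folklore] -/
theorem exists_isAssPt_minimal [NoetherianSpace Z] {y₀ : Z} (h₀ : IsAssPt (A := A) 𝔘 L L' y₀) :
    ∃ ζ : Z, IsAssPt (A := A) 𝔘 L L' ζ ∧
      ∀ y : Z, IsAssPt (A := A) 𝔘 L L' y → ζ ⤳ y → y = ζ := by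
  let S : Set (Closeds Z) := {C | ∃ y, IsAssPt (A := A) 𝔘 L L' y ∧ (C : Set Z) = closure {y}}
  have hS : S.Nonempty := ⟨⟨closure {y₀}, isClosed_closure⟩, y₀, h₀, rfl⟩
  obtain ⟨C, ⟨ζ, hζ, hC⟩, hmin⟩ := (wellFounded_lt (α := Closeds Z)).has_min S hS
  refine ⟨ζ, hζ, fun y hy hzy => eq_of_closure_eq ?_⟩
  have hle : (⟨closure {y}, isClosed_closure⟩ : Closeds Z) ≤ C := by
    change closure {y} ⊆ (C : Set Z)
    rw [hC]
    exact closure_minimal (Set.singleton_subset_iff.2 (specializes_iff_mem_closure.1 hzy))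
      isClosed_closure
  have hnot := hmin ⟨closure {y}, isClosed_closure⟩ ⟨y, hy, rfl⟩
  rcases hle.lt_or_eq with hlt | heq
  · exact absurd hlt hnot
  · exact (congrArg (fun D : Closeds Z => (D : Set Z)) heq).trans hC


variable {𝔘 L L'} (hL : IsCoherent 𝔘 L) (hL' : IsCoherent 𝔘 L')
include hL hL'


/-- **From an annihilator prime to an associated point**: if the class of `x ∈ L t` in
`L t / L' t` has annihilator the prime `𝔭_y` of a point `y ∈ U_t`, then `y` is an associated point
of `𝓛/𝓛'` (localize at `y`). [folklore] -/
theorem isAssPt_of_annihilator {t : Finset ι} (ht : t.Nonempty) (y : 𝔘.U t) {x : Z.functionField}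
    (hx : x ∈ L t)
    (hann : ∀ b : Γ(Z, 𝔘.U t), algebraMap Γ(Z, 𝔘.U t) Z.functionField b * x ∈ L' t ↔
      b ∈ ((𝔘.affine ht).primeIdealOf y).asIdeal) :
    IsAssPt (A := A) 𝔘 L L' (y : Z) := by
  obtain ⟨a, ha⟩ := ht
  have hya : (y : Z) ∈ 𝔘.U {a} := 𝔘.le_single ha y.2
  have hL't : ∀ (b : Γ(Z, 𝔘.U t)) z, z ∈ L' t → algebraMap Γ(Z, 𝔘.U t) Z.functionField b * z ∈ L' t :=
    fun b z hz => hL'.smul_mem ⟨a, ha⟩ b hz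
  refine ⟨a, hya, x, ?_, ?_, ?_⟩
  · rw [← hL.stalkSpan_eq_single ha y.2]
    exact subset_stalkSpan _ _ hx
  · rw [← hL'.stalkSpan_eq_single ha y.2, mem_stalkSpan_iff_exists (𝔘.affine ⟨a, ha⟩) y hL't]
    rintro ⟨b, hb, hbx⟩
    exact hb ((hann b).1 hbx)
  · intro f hf hfu
    rw [← hL'.stalkSpan_eq_single ha y.2]
    obtain ⟨c, b, hb, e⟩ := (isRegularAt_iff_exists (𝔘.affine ⟨a, ha⟩) y f).1 hf
    have hbu : IsUnitAt (y : Z) (algebraMap Γ(Z, 𝔘.U t) Z.functionField b) :=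
      (isUnitAt_algebraMap_iff (𝔘.affine ⟨a, ha⟩) y b).2 hb
    -- `c` vanishes at `y`, for otherwise `f = c / b` would be a unit at `y`
    have hc : c ∈ ((𝔘.affine ⟨a, ha⟩).primeIdealOf y).asIdeal := by
      by_contra hc
      have hcu : IsUnitAt (y : Z) (algebraMap Γ(Z, 𝔘.U t) Z.functionField c) :=
        (isUnitAt_algebraMap_iff (𝔘.affine ⟨a, ha⟩) y c).2 hc
      apply hfu
      have ef : f = algebraMap Γ(Z, 𝔘.U t) Z.functionField c /
          algebraMap Γ(Z, 𝔘.U t) Z.functionField b := by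
        rw [eq_div_iff hbu.ne_zero, e]
      rw [ef]
      exact hcu.div hbu
    have hcx : algebraMap Γ(Z, 𝔘.U t) Z.functionField c * x ∈ L' t := (hann c).2 hc
    -- `f x = b⁻¹ (c x)`
    have efx : f * x = (algebraMap Γ(Z, 𝔘.U t) Z.functionField b)⁻¹ *
        (algebraMap Γ(Z, 𝔘.U t) Z.functionField c * x) := by
      rw [← e, show f * algebraMap Γ(Z, 𝔘.U t) Z.functionField b * x =
          algebraMap Γ(Z, 𝔘.U t) Z.functionField b * (f * x) by ring,
        inv_mul_cancel_left₀ hbu.ne_zero]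
    rw [efx]
    exact isRegularAt_mul_mem_stalkSpan hbu.inv.isRegularAt (subset_stalkSpan _ _ hcx)

/-- **Associated points exist**: if `L' t ≠ L t` (with `L' t ≤ L t`) on some chart of a locally
Noetherian `Z`, then `𝓛/𝓛'` has an associated point in `U_t` (an associated prime of the non-zero
finitely generated `Γ(U_t)`-module `L t / L' t`, Mathlib `associatedPrimes.nonempty`).
[folklore] -/
theorem exists_isAssPt [IsLocallyNoetherian Z]
    {t : Finset ι} (ht : t.Nonempty) (hle : L' t ≤ L t) (hne : L' t ≠ L t) :
    ∃ y ∈ 𝔘.U t, IsAssPt (A := A) 𝔘 L L' y := by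
  classical
  haveI := IsCoherent.isNoetherianRing_sections (𝔘 := 𝔘) ht
  let M : Submodule Γ(Z, 𝔘.U t) Z.functionField := hL.chartModule ht
  let M' : Submodule Γ(Z, 𝔘.U t) Z.functionField := hL'.chartModule ht
  let N : Submodule Γ(Z, 𝔘.U t) M := M'.comap M.subtype
  haveI : Nontrivial (M ⧸ N) := by
    obtain ⟨x, hxM, hxM'⟩ := SetLike.exists_of_lt (lt_of_le_of_ne hle hne)
    refine ⟨⟨Submodule.Quotient.mk ⟨x, (hL.mem_chartModule ht).2 hxM⟩, 0, ?_⟩⟩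
    rw [Ne, Submodule.Quotient.mk_eq_zero]
    exact hxM'
  obtain ⟨p, hp⟩ := associatedPrimes.nonempty Γ(Z, 𝔘.U t) (M ⧸ N)
  obtain ⟨hprime, q, hq⟩ := (isAssociatedPrime_iff.1 hp)
  obtain ⟨m, rfl⟩ := Submodule.Quotient.mk_surjective N q
  let y : 𝔘.U t := ⟨(𝔘.affine ht).fromSpec ⟨p, hprime⟩, FieldNorm.fromSpec_mem (𝔘.affine ht) _⟩
  have hy : (𝔘.affine ht).primeIdealOf y = ⟨p, hprime⟩ := FieldNorm.primeIdealOf_fromSpec _ _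
  refine ⟨y, y.2, isAssPt_of_annihilator hL hL' ht y (x := (m : Z.functionField)) m.2 fun b => ?_⟩
  rw [hy]
  change _ ↔ b ∈ p
  rw [hq, Submodule.mem_colon_singleton, ← Submodule.Quotient.mk_smul, Submodule.mem_bot,
    Submodule.Quotient.mk_eq_zero, Submodule.mem_comap, Submodule.subtype_apply, Submodule.coe_smul,
    Algebra.smul_def]
  exact Iff.rfl

end AssPt

/-! ### The colon family `Γ(U_t, (𝓛' :_𝓛 𝔭))` -/

section Colon

variable {ι : Type} (𝔘 : CoverData Z ι) (ζ : Z) (L L' : Finset ι → Submodule A Z.functionField)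

/-- **The colon family** `t ↦ Γ(U_t, (𝓛' :_𝓛 𝔭))`, `𝔭` the ideal of `closure {ζ}`: the `x ∈ L t`
with `f x ∈ 𝓛'_y` for every `y ∈ U_t` and every `f ∈ 𝔭_y`, where `𝔭_y ⊆ K(Z)` consists of the
functions regular at `y` which, when `ζ ⤳ y`, are non-units at `ζ` (`𝔭_y = 𝒪_{Z,y}` off
`closure {ζ}`). The pointwise definition makes it monotone in `t`; `mem_colonFam_iff` identifies it
with `(L' t :_{L t} 𝔭_{U_t}(ζ))` chartwise. [folklore] -/
def colonFam (t : Finset ι) : Submodule A Z.functionField where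
  carrier := {x | x ∈ L t ∧ ∀ y ∈ 𝔘.U t, ∀ f : Z.functionField, IsRegularAt y f →
    (ζ ⤳ y → ¬IsUnitAt ζ f) → f * x ∈ stalkSpan (A := A) y (L' t : Set Z.functionField)}
  zero_mem' := ⟨(L t).zero_mem, fun _ _ _ _ _ => by rw [mul_zero]; exact Submodule.zero_mem _⟩
  add_mem' := fun {x x'} hx hx' => ⟨(L t).add_mem hx.1 hx'.1, fun y hy f hf hfz => by
    rw [mul_add]; exact Submodule.add_mem _ (hx.2 y hy f hf hfz) (hx'.2 y hy f hf hfz)⟩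
  smul_mem' := fun a x hx => ⟨(L t).smul_mem a hx.1, fun y hy f hf hfz => by
    rw [mul_smul_comm]; exact Submodule.smul_mem _ a (hx.2 y hy f hf hfz)⟩

variable {𝔘 ζ L L'}

/-- Membership in the colon family (definition). [folklore] -/
theorem mem_colonFam {t : Finset ι} {x : Z.functionField} :
    x ∈ colonFam 𝔘 ζ L L' t ↔ x ∈ L t ∧ ∀ y ∈ 𝔘.U t, ∀ f : Z.functionField, IsRegularAt y f →
      (ζ ⤳ y → ¬IsUnitAt ζ f) → f * x ∈ stalkSpan (A := A) y (L' t : Set Z.functionField) :=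
  Iff.rfl

/-- `colonFam ≤ L`. [folklore] -/
theorem colonFam_le (t : Finset ι) : colonFam 𝔘 ζ L L' t ≤ L t := fun _ hx => hx.1

/-- `L' ≤ colonFam`. [folklore] -/
theorem le_colonFam (hle : ∀ t, L' t ≤ L t) (t : Finset ι) : L' t ≤ colonFam 𝔘 ζ L L' t :=
  fun _ hx => ⟨hle t hx, fun _ _ _ hf _ => isRegularAt_mul_mem_stalkSpan hf (subset_stalkSpan _ _ hx)⟩

/-- The colon family is monotone. [folklore] -/
theorem colonFam_mono (hLm : Monotone L) (hL'm : Monotone L') : Monotone (colonFam 𝔘 ζ L L') :=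
  fun _ _ hst _ hx => ⟨hLm hst hx.1, fun y hy f hf hfz =>
    stalkSpan_mono y (hL'm hst) (hx.2 y (𝔘.anti hst hy) f hf hfz)⟩

/-- On a chart through `ζ`, `𝔪_ζ x ⊆ 𝓛'_ζ` for `x` in the colon family. [folklore] -/
theorem mul_mem_stalkSpan_of_mem_colonFam {t : Finset ι} (hζ : ζ ∈ 𝔘.U t) {x : Z.functionField}
    (hx : x ∈ colonFam 𝔘 ζ L L' t) {f : Z.functionField} (hf : IsRegularAt ζ f)
    (hfu : ¬IsUnitAt ζ f) : f * x ∈ stalkSpan (A := A) ζ (L' t : Set Z.functionField) :=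
  hx.2 ζ hζ f hf fun _ => hfu

variable (hL : IsCoherent 𝔘 L) (hL' : IsCoherent 𝔘 L')
include hL hL'

omit hL in
/-- **Chart description of the colon family**: for `t ≠ ∅`,
`colonFam t = (L' t :_{L t} 𝔭_{U_t}(ζ))` — `x ∈ L t` lies in the colon family iff `b x ∈ L' t` for
every `b` in the ideal of `closure {ζ}` on the chart `U_t`. [folklore] -/
theorem mem_colonFam_iff {t : Finset ι} (ht : t.Nonempty) {x : Z.functionField} :
    x ∈ colonFam 𝔘 ζ L L' t ↔ x ∈ L t ∧ ∀ b ∈ pointIdeal (𝔘.affine ht) ζ,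
      algebraMap Γ(Z, 𝔘.U t) Z.functionField b * x ∈ L' t := by
  have hL't : ∀ (b : Γ(Z, 𝔘.U t)) z, z ∈ L' t → algebraMap Γ(Z, 𝔘.U t) Z.functionField b * z ∈ L' t :=
    fun b z hz => hL'.smul_mem ht b hz
  constructor
  · rintro ⟨hxL, hx⟩
    refine ⟨hxL, fun b hb => ?_⟩
    refine mem_of_forall_mem_stalkSpan (𝔘.affine ht) hL't fun y => hx y y.2 _
      (isRegularAt_algebraMap_sections y b) fun hzy => ?_
    have hζt : ζ ∈ 𝔘.U t := mem_of_specializes_of_mem hzy y.2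
    exact (mem_pointIdeal_iff_of_mem (𝔘.affine ht) hζt b).1 hb
  · rintro ⟨hxL, hx⟩
    refine ⟨hxL, fun y hy f hf hfz => ?_⟩
    by_cases hzy : ζ ⤳ y
    · -- `f = c / b` with `b(y) ≠ 0`; then `c` vanishes at `ζ`, so `c ∈ 𝔭` and `c x ∈ L' t`
      have hζt : ζ ∈ 𝔘.U t := mem_of_specializes_of_mem hzy hy
      obtain ⟨c, b, hb, e⟩ := (isRegularAt_iff_exists (𝔘.affine ht) ⟨y, hy⟩ f).1 hf
      have hbu : IsUnitAt y (algebraMap Γ(Z, 𝔘.U t) Z.functionField b) :=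
        (isUnitAt_algebraMap_iff (𝔘.affine ht) ⟨y, hy⟩ b).2 hb
      have hc : c ∈ pointIdeal (𝔘.affine ht) ζ := by
        rw [mem_pointIdeal_iff_of_mem (𝔘.affine ht) hζt]
        intro hcu
        apply hfz hzy
        have ef : f = algebraMap Γ(Z, 𝔘.U t) Z.functionField c /
            algebraMap Γ(Z, 𝔘.U t) Z.functionField b := by
          rw [eq_div_iff hbu.ne_zero, e]
        rw [ef]
        exact hcu.div (isUnitAt_of_specializes hzy hbu)
      have efx : f * x = (algebraMap Γ(Z, 𝔘.U t) Z.functionField b)⁻¹ *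
          (algebraMap Γ(Z, 𝔘.U t) Z.functionField c * x) := by
        rw [← e, show f * algebraMap Γ(Z, 𝔘.U t) Z.functionField b * x =
          algebraMap Γ(Z, 𝔘.U t) Z.functionField b * (f * x) by ring,
        inv_mul_cancel_left₀ hbu.ne_zero]
      rw [efx]
      exact isRegularAt_mul_mem_stalkSpan hbu.inv.isRegularAt (subset_stalkSpan _ _ (hx c hc))
    · -- off `closure {ζ}`: some `c ∈ 𝔭` is a unit at `y`, and `c x ∈ L' t`
      obtain ⟨c, hc, hcu⟩ := exists_mem_pointIdeal_isUnitAt (𝔘.affine ht) ⟨y, hy⟩ hzy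
      have ex : x = (algebraMap Γ(Z, 𝔘.U t) Z.functionField c)⁻¹ *
          (algebraMap Γ(Z, 𝔘.U t) Z.functionField c * x) := by
        rw [← mul_assoc, inv_mul_cancel₀ hcu.ne_zero, one_mul]
      rw [ex]
      exact isRegularAt_mul_mem_stalkSpan hf
        (isRegularAt_mul_mem_stalkSpan hcu.inv.isRegularAt (subset_stalkSpan _ _ (hx c hc)))

omit hL in
/-- **On the charts missing `ζ` the colon family is `L'`.** [folklore] -/
theorem colonFam_eq_of_notMem (hle : ∀ t, L' t ≤ L t) {t : Finset ι} (ht : t.Nonempty)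
    (hζ : ζ ∉ 𝔘.U t) :
    colonFam 𝔘 ζ L L' t = L' t := by
  refine le_antisymm (fun x hx => ?_) (le_colonFam hle t)
  have hL't : ∀ (b : Γ(Z, 𝔘.U t)) z, z ∈ L' t → algebraMap Γ(Z, 𝔘.U t) Z.functionField b * z ∈ L' t :=
    fun b z hz => hL'.smul_mem ht b hz
  refine mem_of_forall_mem_stalkSpan (𝔘.affine ht) hL't fun y => ?_
  have h := hx.2 y y.2 1 isRegularAt_one fun hzy => absurd (mem_of_specializes_of_mem hzy y.2) hζ
  rwa [one_mul] at h

omit hL' in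
/-- The colon family as a `Γ(U_t, 𝒪_Z)`-submodule of `L t`. [folklore] -/
theorem algebraMap_mul_mem_colonFam {t : Finset ι} (ht : t.Nonempty) (b : Γ(Z, 𝔘.U t))
    {x : Z.functionField} (hx : x ∈ colonFam 𝔘 ζ L L' t) :
    algebraMap Γ(Z, 𝔘.U t) Z.functionField b * x ∈ colonFam 𝔘 ζ L L' t := by
  refine ⟨hL.smul_mem ht b hx.1, fun y hy f hf hfz => ?_⟩
  rw [mul_left_comm]
  exact isRegularAt_mul_mem_stalkSpan (isRegularAt_algebraMap_sections ⟨y, hy⟩ b)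
    (hx.2 y hy f hf hfz)

/-- **The colon family is coherent** (`Z` locally Noetherian, scalars of `A` regular on `Z`):
finite generation from that of `L t` over the Noetherian `Γ(U_t)`; independence of the stalks from
the chart by localizing the chart description `(L' t :_{L t} 𝔭)` — `𝔭` being finitely generated,
finitely many denominators non-vanishing at `y` push a section of `(𝓛' :_𝓛 𝔭)` over `U_t` into
one over `U_s ⊇ U_t`. [folklore] -/
theorem isCoherent_colonFam [IsLocallyNoetherian Z]
    (hA : ∀ (a : A) (y : Z), IsRegularAt y (algebraMap A Z.functionField a)) :
    IsCoherent 𝔘 (colonFam 𝔘 ζ L L') where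
  mono := colonFam_mono hL.mono hL'.mono
  smul_mem _ ht b _ hx := algebraMap_mul_mem_colonFam hL ht b hx
  fg t ht := by
    let N : Submodule Γ(Z, 𝔘.U t) Z.functionField :=
      { carrier := colonFam 𝔘 ζ L L' t
        zero_mem' := Submodule.zero_mem _
        add_mem' := fun hx hy => Submodule.add_mem _ hx hy
        smul_mem' := fun b x hx => by
          rw [Algebra.smul_def]
          exact algebraMap_mul_mem_colonFam hL ht b hx }
    obtain ⟨S, hS, hiff⟩ := hL.exists_finset_of_le hA ht N fun x hx => (colonFam_le t) hx
    exact ⟨S, hS, fun x hx => (hiff x).1 hx⟩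
  stalk_le s t hs hst y hy := by
    classical
    have ht : t.Nonempty := hs.mono hst
    have hys : y ∈ 𝔘.U s := 𝔘.anti hst hy
    haveI := IsCoherent.isNoetherianRing_sections (𝔘 := 𝔘) hs
    have hLs : ∀ (b : Γ(Z, 𝔘.U s)) z, z ∈ L s → algebraMap Γ(Z, 𝔘.U s) Z.functionField b * z ∈ L s :=
      fun b z hz => hL.smul_mem hs b hz
    have hL's : ∀ (b : Γ(Z, 𝔘.U s)) z, z ∈ L' s → algebraMap Γ(Z, 𝔘.U s) Z.functionField b * z ∈ L' s :=
      fun b z hz => hL'.smul_mem hs b hz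
    have hCs : ∀ (b : Γ(Z, 𝔘.U s)) z, z ∈ colonFam 𝔘 ζ L L' s →
        algebraMap Γ(Z, 𝔘.U s) Z.functionField b * z ∈ colonFam 𝔘 ζ L L' s :=
      fun b z hz => algebraMap_mul_mem_colonFam hL hs b hz
    -- it suffices to push each `x ∈ colonFam t` into `colonFam s` by a denominator
    refine stalkSpan_le (fun x hx => ?_) fun f z hf hz => isRegularAt_mul_mem_stalkSpan hf hz
    change x ∈ colonFam 𝔘 ζ L L' t at hx
    rw [SetLike.mem_coe, mem_stalkSpan_iff_exists (𝔘.affine hs) ⟨y, hys⟩ hCs]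
    -- a denominator bringing `x` into `L s`
    have hxLs : x ∈ stalkSpan (A := A) y (L s : Set Z.functionField) :=
      hL.stalk_le hs hst hy (subset_stalkSpan _ _ hx.1)
    obtain ⟨b₀, hb₀, hb₀x⟩ := (mem_stalkSpan_iff_exists (𝔘.affine hs) ⟨y, hys⟩ hLs x).1 hxLs
    -- generators of `𝔭_s` and, for each, a denominator bringing `g x` into `L' s`
    obtain ⟨G, hG⟩ := (isNoetherianRing_iff_ideal_fg Γ(Z, 𝔘.U s)).1 inferInstance
      (pointIdeal (𝔘.affine hs) ζ)
    have hgx : ∀ g : Γ(Z, 𝔘.U s), g ∈ pointIdeal (𝔘.affine hs) ζ →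
        ∃ c : Γ(Z, 𝔘.U s), c ∉ ((𝔘.affine hs).primeIdealOf ⟨y, hys⟩).asIdeal ∧
          algebraMap Γ(Z, 𝔘.U s) Z.functionField c *
            (algebraMap Γ(Z, 𝔘.U s) Z.functionField g * x) ∈ L' s := by
      intro g hg
      have hgt : Z.presheaf.map (homOfLE (𝔘.anti hst)).op g ∈ pointIdeal (𝔘.affine ht) ζ :=
        map_mem_pointIdeal (𝔘.affine hs) (𝔘.affine ht) (𝔘.anti hst) ζ hg
      have hgxt : algebraMap Γ(Z, 𝔘.U s) Z.functionField g * x ∈ L' t := by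
        rw [← algebraMap_map (𝔘.anti hst) g]
        exact ((mem_colonFam_iff hL' ht).1 hx).2 _ hgt
      have hgxs : algebraMap Γ(Z, 𝔘.U s) Z.functionField g * x ∈
          stalkSpan (A := A) y (L' s : Set Z.functionField) :=
        hL'.stalk_le hs hst hy (subset_stalkSpan _ _ hgxt)
      exact (mem_stalkSpan_iff_exists (𝔘.affine hs) ⟨y, hys⟩ hL's _).1 hgxs
    choose! c hc hcx using hgx
    refine ⟨b₀ * ∏ g ∈ G, c g, ?_, ?_⟩
    · intro hmem
      rcases ((𝔘.affine hs).primeIdealOf ⟨y, hys⟩).2.mem_or_mem hmem with h | h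
      · exact hb₀ h
      · obtain ⟨g, hg, hcg⟩ :=
          (Ideal.IsPrime.prod_mem_iff (hp := ((𝔘.affine hs).primeIdealOf ⟨y, hys⟩).2)).1 h
        exact hc g (hG ▸ Ideal.subset_span hg) hcg
    · rw [mem_colonFam_iff hL' hs]
      refine ⟨?_, fun g' hg' => ?_⟩
      · rw [map_mul, mul_comm (algebraMap _ _ b₀), mul_assoc]
        exact hLs _ _ hb₀x
      · -- reduce to the generators `g ∈ G` of `𝔭_s`
        rw [← hG] at hg'
        rw [← mul_assoc, ← map_mul]
        induction hg' using Submodule.span_induction with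
        | mem g hg =>
          have hprod : (∏ h ∈ G, c h) = c g * ∏ h ∈ G.erase g, c h :=
            (Finset.mul_prod_erase G (fun h => c h) hg).symm
          have key := hcx g (hG ▸ Ideal.subset_span hg)
          rw [hprod, show algebraMap Γ(Z, 𝔘.U s) Z.functionField
              (g * (b₀ * (c g * ∏ h ∈ G.erase g, c h))) * x =
            algebraMap Γ(Z, 𝔘.U s) Z.functionField (b₀ * ∏ h ∈ G.erase g, c h) *
              (algebraMap Γ(Z, 𝔘.U s) Z.functionField (c g) *
                (algebraMap Γ(Z, 𝔘.U s) Z.functionField g * x)) by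
            simp only [map_mul]; ring]
          exact hL's _ _ key
        | zero => rw [zero_mul, map_zero, zero_mul]; exact (L' s).zero_mem
        | add g g' _ _ hg hg' =>
          rw [add_mul, map_add, add_mul]
          exact (L' s).add_mem hg hg'
        | smul r g _ hg =>
          rw [smul_eq_mul, mul_assoc, map_mul, mul_assoc]
          exact hL's r _ hg

/-- **Torsion-freeness of `(𝓛' :_𝓛 𝔭)/𝓛'` at a minimal associated point.** Suppose `ζ` is an
associated point of `𝓛/𝓛'` with no other associated point in `closure {ζ}`. If a section `x` of
the colon family over a chart `U_t ∋ ζ` lies in the stalk `𝓛'_ζ`, then `x ∈ L' t`: otherwise an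
associated prime of `L t / L' t` containing the annihilator of the class of `x` (Mathlib
`exists_le_isAssociatedPrime_of_isNoetherianRing`) is the prime of an associated point `y` with
`ζ ⤳ y` (the annihilator contains `𝔭`) and `y ≠ ζ` (it contains a function non-vanishing at `ζ`).
This is the injectivity of `Γ(U_t, (𝓛' :_𝓛 𝔭)/𝓛') → ((𝓛' :_𝓛 𝔭)/𝓛')_ζ` behind The Stacks
Project, Tag 01YF. [folklore] -/
theorem mem_of_mem_colonFam_of_mem_stalkSpan [IsLocallyNoetherian Z]
    (hmin : ∀ y : Z, IsAssPt (A := A) 𝔘 L L' y → ζ ⤳ y → y = ζ)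
    {t : Finset ι} (ht : t.Nonempty) (hζ : ζ ∈ 𝔘.U t) {x : Z.functionField}
    (hx : x ∈ colonFam 𝔘 ζ L L' t)
    (hxζ : x ∈ stalkSpan (A := A) ζ (L' t : Set Z.functionField)) : x ∈ L' t := by
  classical
  haveI := IsCoherent.isNoetherianRing_sections (𝔘 := 𝔘) ht
  have hL't : ∀ (b : Γ(Z, 𝔘.U t)) z, z ∈ L' t → algebraMap Γ(Z, 𝔘.U t) Z.functionField b * z ∈ L' t :=
    fun b z hz => hL'.smul_mem ht b hz
  -- a denominator `d` non-vanishing at `ζ` with `d x ∈ L' t`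
  obtain ⟨d, hd, hdx⟩ := (mem_stalkSpan_iff_exists (𝔘.affine ht) ⟨ζ, hζ⟩ hL't x).1 hxζ
  by_contra hxL'
  -- the class of `x` in `L t / L' t`
  let M : Submodule Γ(Z, 𝔘.U t) Z.functionField := hL.chartModule ht
  let M' : Submodule Γ(Z, 𝔘.U t) Z.functionField := hL'.chartModule ht
  let N : Submodule Γ(Z, 𝔘.U t) M := M'.comap M.subtype
  let q : M ⧸ N := Submodule.Quotient.mk ⟨x, (hL.mem_chartModule ht).2 hx.1⟩
  have hq : q ≠ 0 := by
    intro h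
    rw [Submodule.Quotient.mk_eq_zero] at h
    exact hxL' h
  have hann : ∀ b : Γ(Z, 𝔘.U t), b ∈ (⊥ : Submodule Γ(Z, 𝔘.U t) (M ⧸ N)).colon {q} ↔
      algebraMap Γ(Z, 𝔘.U t) Z.functionField b * x ∈ L' t := fun b => by
    rw [Submodule.mem_colon_singleton, ← Submodule.Quotient.mk_smul, Submodule.mem_bot,
      Submodule.Quotient.mk_eq_zero, Submodule.mem_comap, Submodule.subtype_apply, Submodule.coe_smul,
      Algebra.smul_def]
    exact Iff.rfl
  obtain ⟨P, hP, hcolon⟩ := exists_le_isAssociatedPrime_of_isNoetherianRing Γ(Z, 𝔘.U t) q hq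
  obtain ⟨hprime, w, hw⟩ := isAssociatedPrime_iff.1 hP
  obtain ⟨m, rfl⟩ := Submodule.Quotient.mk_surjective N w
  -- the point `y` of `P`
  let y : 𝔘.U t := ⟨(𝔘.affine ht).fromSpec ⟨P, hprime⟩, FieldNorm.fromSpec_mem (𝔘.affine ht) _⟩
  have hy : (𝔘.affine ht).primeIdealOf y = ⟨P, hprime⟩ := FieldNorm.primeIdealOf_fromSpec _ _
  -- `y` is an associated point
  have hyass : IsAssPt (A := A) 𝔘 L L' (y : Z) := by
    refine isAssPt_of_annihilator hL hL' ht y (x := (m : Z.functionField)) m.2 fun b => ?_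
    rw [hy]
    change _ ↔ b ∈ P
    rw [hw, Submodule.mem_colon_singleton, ← Submodule.Quotient.mk_smul, Submodule.mem_bot,
      Submodule.Quotient.mk_eq_zero, Submodule.mem_comap, Submodule.subtype_apply, Submodule.coe_smul,
      Algebra.smul_def]
    exact Iff.rfl
  -- `ζ ⤳ y`: the ideal of `closure {ζ}` kills the class of `x`, hence lies in `P = 𝔭_y`
  have hzy : ζ ⤳ (y : Z) := by
    have hle' : pointIdeal (𝔘.affine ht) ζ ≤ ((𝔘.affine ht).primeIdealOf y).asIdeal := by
      rw [hy]
      intro b hb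
      exact hcolon ((hann b).2 (((mem_colonFam_iff hL' ht).1 hx).2 b hb))
    exact specializes_iff_mem_closure.2
      ((vanishingIdeal_ideal_le_primeIdealOf_iff (𝔘.affine ht) ⟨closure {ζ}, isClosed_closure⟩ y).1
        hle')
  -- `y ≠ ζ`: `d ∈ P` but `d ∉ 𝔭_ζ`
  have hne : (y : Z) ≠ ζ := by
    intro e
    have hdP : d ∈ ((𝔘.affine ht).primeIdealOf y).asIdeal := by
      rw [hy]
      exact hcolon ((hann d).2 hdx)
    have : (y : 𝔘.U t) = ⟨ζ, hζ⟩ := Subtype.ext e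
    rw [this] at hdP
    exact hd hdP
  exact hne (hmin y hyass hzy)

/-- **A generator for the piece**: at an associated point `ζ` of `𝓛/𝓛'` on the vertex chart
`U_{a} ∋ ζ` there is a section `x` of the colon family over `U_{a}` which is not in the stalk `𝓛'_ζ`
(clear the denominators of a stalk witness against the finitely many generators of `𝔭`).
[folklore] -/
theorem exists_mem_colonFam_notMem [IsLocallyNoetherian Z] {a : ι} (hζa : ζ ∈ 𝔘.U {a})
    {v : Z.functionField} (hv : v ∈ stalkSpan (A := A) ζ (L {a} : Set Z.functionField))
    (hv' : v ∉ stalkSpan (A := A) ζ (L' {a} : Set Z.functionField))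
    (hmv : ∀ f : Z.functionField, IsRegularAt ζ f → ¬IsUnitAt ζ f →
      f * v ∈ stalkSpan (A := A) ζ (L' {a} : Set Z.functionField)) :
    ∃ x ∈ colonFam 𝔘 ζ L L' {a}, x ∉ stalkSpan (A := A) ζ (L' {a} : Set Z.functionField) := by
  classical
  have ha : ({a} : Finset ι).Nonempty := Finset.singleton_nonempty a
  haveI := IsCoherent.isNoetherianRing_sections (𝔘 := 𝔘) ha
  set R := Γ(Z, 𝔘.U {a}) with hR
  have hLa : ∀ (b : R) z, z ∈ L {a} → algebraMap R Z.functionField b * z ∈ L {a} :=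
    fun b z hz => hL.smul_mem ha b hz
  have hL'a : ∀ (b : R) z, z ∈ L' {a} → algebraMap R Z.functionField b * z ∈ L' {a} :=
    fun b z hz => hL'.smul_mem ha b hz
  let ζ' : 𝔘.U {a} := ⟨ζ, hζa⟩
  -- clear the denominator of `v`
  obtain ⟨b₀, hb₀, hx₁⟩ := (mem_stalkSpan_iff_exists (𝔘.affine ha) ζ' hLa v).1 hv
  set x₁ := algebraMap R Z.functionField b₀ * v with hx₁def
  have hb₀u : IsUnitAt ζ (algebraMap R Z.functionField b₀) :=
    (isUnitAt_algebraMap_iff (𝔘.affine ha) ζ' b₀).2 hb₀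
  -- generators of `𝔭` and denominators for each
  obtain ⟨G, hG⟩ := (isNoetherianRing_iff_ideal_fg R).1 inferInstance (pointIdeal (𝔘.affine ha) ζ)
  have hgx : ∀ g : R, g ∈ pointIdeal (𝔘.affine ha) ζ → ∃ c : R,
      c ∉ ((𝔘.affine ha).primeIdealOf ζ').asIdeal ∧
        algebraMap R Z.functionField c * (algebraMap R Z.functionField g * x₁) ∈ L' {a} := by
    intro g hg
    have hgu : ¬IsUnitAt ζ (algebraMap R Z.functionField g) :=
      (mem_pointIdeal_iff_of_mem (𝔘.affine ha) hζa g).1 hg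
    have h1 : algebraMap R Z.functionField g * x₁ ∈
        stalkSpan (A := A) ζ (L' {a} : Set Z.functionField) := by
      rw [hx₁def, mul_left_comm]
      exact isRegularAt_mul_mem_stalkSpan hb₀u.isRegularAt
        (hmv _ (isRegularAt_algebraMap_sections ζ' g) hgu)
    exact (mem_stalkSpan_iff_exists (𝔘.affine ha) ζ' hL'a _).1 h1
  choose! c hc hcx using hgx
  set C : R := ∏ g ∈ G, c g with hC
  have hCu : IsUnitAt ζ (algebraMap R Z.functionField C) := by
    rw [isUnitAt_algebraMap_iff (𝔘.affine ha) ζ' C]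
    intro hmem
    obtain ⟨g, hg, hcg⟩ :=
      (Ideal.IsPrime.prod_mem_iff (hp := ((𝔘.affine ha).primeIdealOf ζ').2)).1 hmem
    exact hc g (hG ▸ Ideal.subset_span hg) hcg
  refine ⟨algebraMap R Z.functionField C * x₁, ?_, ?_⟩
  · rw [mem_colonFam_iff hL' ha]
    refine ⟨hLa _ _ hx₁, fun g' hg' => ?_⟩
    rw [← hG] at hg'
    rw [← mul_assoc, ← map_mul]
    induction hg' using Submodule.span_induction with
    | mem g hg =>
      have hprod : C = c g * ∏ h ∈ G.erase g, c h := (Finset.mul_prod_erase G (fun h => c h) hg).symm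
      rw [hprod]
      rw [show algebraMap R Z.functionField (g * (c g * ∏ h ∈ G.erase g, c h)) * x₁ =
          algebraMap R Z.functionField (∏ h ∈ G.erase g, c h) *
            (algebraMap R Z.functionField (c g) * (algebraMap R Z.functionField g * x₁)) by
        rw [map_mul, map_mul]; ring]
      exact hL'a _ _ (hcx g (hG ▸ Ideal.subset_span hg))
    | zero => rw [zero_mul, map_zero, zero_mul]; exact (L' {a}).zero_mem
    | add g g' _ _ hg hg' => rw [add_mul, map_add, add_mul]; exact (L' {a}).add_mem hg hg'
    | smul r g _ hg => rw [smul_eq_mul, mul_assoc, map_mul, mul_assoc]; exact hL'a r _ hg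
  · intro hmem
    apply hv'
    have hCb : IsUnitAt ζ (algebraMap R Z.functionField (C * b₀)) := by
      rw [map_mul]; exact hCu.mul hb₀u
    have e : v = (algebraMap R Z.functionField (C * b₀))⁻¹ *
        (algebraMap R Z.functionField C * x₁) := by
      rw [hx₁def, ← mul_assoc (algebraMap R Z.functionField C), ← map_mul, ← mul_assoc,
        inv_mul_cancel₀ hCb.ne_zero, one_mul]
    rw [e]
    exact isRegularAt_mul_mem_stalkSpan hCb.inv.isRegularAt hmem

end Colon

end FracFamily

end Literature.AlgebraicGeometry.Motives

end
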